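import Summits.ResolutionOfSingularities.ResolutionOfSingularities.Theorems.FrobeniusLadderFInjectiveMacaulayficationBlowupAlgebraLocalRings
import Summits.ResolutionOfSingularities.ResolutionOfSingularities.Theorems.FrobeniusLadderFInjectiveMacaulayficationBlowupAlgebraPolynomial
import Summits.ResolutionOfSingularities.ResolutionOfSingularities.Theorems.FrobeniusLadderFInjectiveMacaulayficationPolynomialLocalizationClauseAtPrime
import Summits.ResolutionOfSingularities.ResolutionOfSingularities.Theorems.FrobeniusLadderFInjectiveMacaulayficationCertifiedCoverCongr
import Literature.AlgebraicGeometry.Resolution.BlowupChartTransition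
import HarnessLib

/-!
# `Bl_I` good at every stalk ⟹ `Bl_{I·R[t]}` good at every stalk (the cylinder step of the R11.11 producer, S4)
# (crux `FInjectiveMacaulayfication` stmt-ResolutionOfSingularities-15315, chain w45a; owner res-D-pv-017 AS res-L1-w45a-stub-5)

Support file for crux stmt-ResolutionOfSingularities-15315 (`FrobeniusLadder.FInjectiveMacaulayfication`), chain w45a.
[OURS · L1 W4.5a] — NOT a statement of any manuscript; AI-written, weaker than expert review.

`affineBlowup_fiClause_polynomial`: `R` a Noetherian domain of characteristic `p`, `I ⊆ R` an ideal; if every stalk of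
`affineBlowup I` is a domain satisfying the crux's clause (every system of parameters weakly regular, parameter ideals Frobenius
closed), then so is every stalk of `affineBlowup (I·R[t])` — i.e. of `Bl_I × 𝔸¹`. Every residue field, no separability.
Proof: a stalk of `Bl_{I R[t]}` is a local ring of a chart `R[t][I R[t]/a]` (`a` a generator of `I`; the charts of a generating
tuple cover, `CertifiedCoverCongr.irrelevant_le_radical_of_sum` with `N = 1`), which is `(R[I/a])[t]`
(`BlowupAlgebraPolynomial.nonempty_ringEquiv_polynomial`, S3); every local ring of `R[I/a]` is a stalk of `Bl_I`
(`BlowupAlgebraLocalRings.exists_affineBlowup_stalk_ringEquiv`), so the clause ascends by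
`PolynomialLocalizationClause.clause_polynomial_atPrime` (S2). Same format in and out: iterate for `𝔸^m`. No definitions, no
named facts. [folklore; cf. DattaMurayama2020 Thm A]
-/

-- single-problem summit: the doubled namespace component is forced
set_option linter.dupNamespace false

noncomputable section

open Polynomial AlgebraicGeometry CategoryTheory Literature.AlgebraicGeometry.Resolution

namespace Summit.ResolutionOfSingularities.ResolutionOfSingularities.Theorems.FInjectiveMacaulayfication.AffineBlowupPolynomial

open Summit.ResolutionOfSingularities.ResolutionOfSingularities.Theorems.FInjectiveMacaulayfication

/-- `B[t] ≅ R[t][I R[t]/a]` for any ring `B ≅ R[I/a]` — `BlowupAlgebraPolynomial.nonempty_ringEquiv_polynomial` with the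
polynomial ring taken over an abstract copy of `R[I/a]` (keeps a single instance path on the coefficients). [folklore] -/
theorem nonempty_ringEquiv_polynomial' {R : Type} [CommRing R] (I : Ideal R) (a : R) {B : Type} [CommRing B]
    (eB : B ≃+* blowupAlgebra I a) : Nonempty (B[X] ≃+* blowupAlgebra (I.map (C : R →+* R[X])) (C a)) := by
  obtain ⟨e⟩ := BlowupAlgebraPolynomial.nonempty_ringEquiv_polynomial I a
  exact ⟨(Polynomial.mapEquiv eB).trans e⟩

set_option maxHeartbeats 800000 in
/-- **Every local ring of every chart `R[t][I R[t]/a]` (`a ∈ I`, `a ≠ 0`) is a domain satisfying the clause** when all stalks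
of `Bl_I(R)` are (`R` Noetherian domain of characteristic `p`): the chart is `(R[I/a])[t]` (S3) and the clause ascends along
`R[I/a] → (R[I/a])[t]` (S2), the local rings of `R[I/a]` being stalks of `Bl_I`. [folklore] -/
theorem chart_fiClause_polynomial (p : ℕ) [Fact p.Prime] (R : Type) [CommRing R] [IsDomain R] [IsNoetherianRing R]
    [CharP R p] (I : Ideal R)
    (hBl : ∀ y : ↥(affineBlowup I), IsDomain ((affineBlowup I).presheaf.stalk y) ∧
      ∀ d : ℕ, ringKrullDim ((affineBlowup I).presheaf.stalk y) = d →
        ∀ s : Fin d → (affineBlowup I).presheaf.stalk y, (Ideal.span (Set.range s)).radical.IsMaximal →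
          RingTheory.Sequence.IsWeaklyRegular ((affineBlowup I).presheaf.stalk y) (List.ofFn s) ∧
          ∀ z : (affineBlowup I).presheaf.stalk y, (∃ e : ℕ, z ^ p ^ e ∈
              Ideal.span ((fun w : (affineBlowup I).presheaf.stalk y => w ^ p ^ e) ''
                (Ideal.span (Set.range s) : Set ((affineBlowup I).presheaf.stalk y)))) →
            z ∈ Ideal.span (Set.range s))
    (a : R) (ha : a ∈ I) (ha0 : a ≠ 0) (Q : Ideal (blowupAlgebra (I.map (C : R →+* R[X])) (C a))) [Q.IsPrime] :
    IsDomain (Localization.AtPrime Q) ∧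
      ∀ d : ℕ, ringKrullDim (Localization.AtPrime Q) = d → ∀ s : Fin d → Localization.AtPrime Q,
        (Ideal.span (Set.range s)).radical.IsMaximal →
          RingTheory.Sequence.IsWeaklyRegular (Localization.AtPrime Q) (List.ofFn s) ∧
          ∀ z : Localization.AtPrime Q, (∃ e : ℕ, z ^ p ^ e ∈ Ideal.span
            ((fun w : Localization.AtPrime Q => w ^ p ^ e) '' (Ideal.span (Set.range s) : Set (Localization.AtPrime Q)))) →
            z ∈ Ideal.span (Set.range s) := by
  -- `R[t][I R[t]/a] ≅ (R[I/a])[t]`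
  obtain ⟨e₃⟩ := nonempty_ringEquiv_polynomial' I a (B := blowupAlgebra I a) (RingEquiv.refl _)
  haveI hq₃p : (Q.comap e₃).IsPrime := Ideal.comap_isPrime e₃ Q
  obtain ⟨e₄⟩ := BlowupFiModelOfCover.nonempty_ringEquiv_localization_of_ringEquiv e₃ (Q.comap e₃) Q fun x =>
    Ideal.mem_comap.symm
  -- `R[I/a]`: Noetherian domain of characteristic `p` with the clause at every prime
  haveI : IsDomain (Localization.Away a) := IsLocalization.isDomain_localization (powers_le_nonZeroDivisors_of_noZeroDivisors ha0)
  haveI : IsDomain (blowupAlgebra I a) := Subalgebra.isDomain _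
  haveI : IsNoetherianRing (blowupAlgebra I a) := isNoetherianRing_blowupAlgebra_of_isNoetherianRing I a
  haveI : CharP (Localization.Away a) p :=
    charP_of_injective_algebraMap (IsLocalization.injective (Localization.Away a) (powers_le_nonZeroDivisors_of_noZeroDivisors ha0)) p
  haveI : CharP (blowupAlgebra I a) p := (algebraMap (blowupAlgebra I a) (Localization.Away a)).charP Subtype.val_injective p
  have hB : ∀ (𝔮 : Ideal (blowupAlgebra I a)) [𝔮.IsPrime], ∀ d : ℕ, ringKrullDim (Localization.AtPrime 𝔮) = d →
      ∀ s : Fin d → Localization.AtPrime 𝔮, (Ideal.span (Set.range s)).radical.IsMaximal →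
        RingTheory.Sequence.IsWeaklyRegular (Localization.AtPrime 𝔮) (List.ofFn s) ∧
        ∀ z : Localization.AtPrime 𝔮, (∃ e : ℕ, z ^ p ^ e ∈ Ideal.span
          ((fun w : Localization.AtPrime 𝔮 => w ^ p ^ e) '' (Ideal.span (Set.range s) : Set (Localization.AtPrime 𝔮)))) →
          z ∈ Ideal.span (Set.range s) := by
    intro 𝔮 _
    obtain ⟨y₀, -, ⟨e₀⟩⟩ := BlowupAlgebraLocalRings.exists_affineBlowup_stalk_ringEquiv a ha 𝔮
    exact DegreeZeroDescent.inlineClause_of_ringEquiv (L' := Localization.AtPrime 𝔮) p e₀ (hBl y₀).2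
  have hcl₃ := PolynomialLocalizationClause.clause_polynomial_atPrime p (blowupAlgebra I a) hB (Q.comap e₃)
  haveI : IsDomain (Localization.AtPrime (Q.comap e₃)) :=
    IsLocalization.isDomain_localization (M := (Q.comap e₃).primeCompl) (Ideal.primeCompl_le_nonZeroDivisors _)
  exact ⟨MulEquiv.isDomain (Localization.AtPrime (Q.comap e₃)) e₄.symm.toMulEquiv,
    DegreeZeroDescent.inlineClause_of_ringEquiv (L := Localization.AtPrime (Q.comap e₃)) (L' := Localization.AtPrime Q) p e₄ hcl₃⟩

set_option maxHeartbeats 1600000 in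
/-- **`Bl_I(R)` good at all stalks ⟹ `Bl_{I R[t]}(R[t])` good at all stalks** (`R` Noetherian domain of characteristic `p`;
the full clause: domain ∧ every system of parameters weakly regular ∧ parameter ideals Frobenius closed). [folklore] -/
theorem affineBlowup_fiClause_polynomial (p : ℕ) [Fact p.Prime] (R : Type) [CommRing R] [IsDomain R] [IsNoetherianRing R]
    [CharP R p] (I : Ideal R)
    (hBl : ∀ y : ↥(affineBlowup I), IsDomain ((affineBlowup I).presheaf.stalk y) ∧
      ∀ d : ℕ, ringKrullDim ((affineBlowup I).presheaf.stalk y) = d →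
        ∀ s : Fin d → (affineBlowup I).presheaf.stalk y, (Ideal.span (Set.range s)).radical.IsMaximal →
          RingTheory.Sequence.IsWeaklyRegular ((affineBlowup I).presheaf.stalk y) (List.ofFn s) ∧
          ∀ z : (affineBlowup I).presheaf.stalk y, (∃ e : ℕ, z ^ p ^ e ∈
              Ideal.span ((fun w : (affineBlowup I).presheaf.stalk y => w ^ p ^ e) ''
                (Ideal.span (Set.range s) : Set ((affineBlowup I).presheaf.stalk y)))) →
            z ∈ Ideal.span (Set.range s)) :
    ∀ y : ↥(affineBlowup (I.map (C : R →+* R[X]))), IsDomain ((affineBlowup (I.map (C : R →+* R[X]))).presheaf.stalk y) ∧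
      ∀ d : ℕ, ringKrullDim ((affineBlowup (I.map (C : R →+* R[X]))).presheaf.stalk y) = d →
        ∀ s : Fin d → (affineBlowup (I.map (C : R →+* R[X]))).presheaf.stalk y, (Ideal.span (Set.range s)).radical.IsMaximal →
          RingTheory.Sequence.IsWeaklyRegular ((affineBlowup (I.map (C : R →+* R[X]))).presheaf.stalk y) (List.ofFn s) ∧
          ∀ z : (affineBlowup (I.map (C : R →+* R[X]))).presheaf.stalk y, (∃ e : ℕ, z ^ p ^ e ∈
              Ideal.span ((fun w : (affineBlowup (I.map (C : R →+* R[X]))).presheaf.stalk y => w ^ p ^ e) ''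
                (Ideal.span (Set.range s) : Set ((affineBlowup (I.map (C : R →+* R[X]))).presheaf.stalk y)))) →
            z ∈ Ideal.span (Set.range s) := by
  classical
  intro y
  -- a finite generating tuple `v` of `I`; its image generates `I' = I·R[t]`, so its charts cover `Bl_{I'}`
  obtain ⟨n, v, hv⟩ := Submodule.fg_iff_exists_fin_generating_family.mp (IsNoetherian.noetherian I)
  have hvI : ∀ j, v j ∈ I := fun j => hv ▸ Ideal.subset_span ⟨j, rfl⟩
  have hv' : ∀ j, C (v j) ∈ I.map (C : R →+* R[X]) := fun j => Ideal.mem_map_of_mem _ (hvI j)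
  have hI' : I.map (C : R →+* R[X]) = Ideal.span (Set.range fun j => C (v j)) := by
    rw [← hv, Ideal.map_span, ← Set.range_comp]; rfl
  have hcov : (HomogeneousIdeal.irrelevant (reesGrading (I.map (C : R →+* R[X])))).toIdeal ≤
      (Ideal.span (Set.range fun j : Fin n => reesT (I := I.map (C : R →+* R[X])) (C (v j)) (hv' j))).radical := by
    refine CertifiedCoverCongr.irrelevant_le_radical_of_sum _ hv' fun b hb => ⟨1, one_pos, ?_⟩
    rw [hI'] at hb
    obtain ⟨c, hc⟩ := Ideal.mem_span_range_iff_exists_fun.mp hb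
    refine ⟨c, fun j => by rw [Nat.sub_self, pow_zero, Ideal.one_eq_top]; exact Submodule.mem_top, ?_⟩
    rw [pow_one, ← hc]
    exact Finset.sum_congr rfl fun j _ => mul_comm _ _
  -- the chart containing `y` and its generator `a = v j ≠ 0`
  obtain ⟨j, hj⟩ := BlowupFiModelOfCover.exists_mem_basicOpen_of_irrelevant_le_radical _ hv' hcov y
  have ha0 : v j ≠ 0 := by
    intro h0
    rw [Proj.mem_basicOpen] at hj
    apply hj
    have : reesT (I := I.map (C : R →+* R[X])) (C (v j)) (hv' j) = 0 := Subtype.ext (by rw [coe_reesT, h0, map_zero, map_zero]; rfl)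
    rw [this]
    exact zero_mem _
  -- the stalk at `y` is a local ring of the homogeneous chart ring, hence of `R[t][I R[t]/a]`
  rw [← Proj.opensRange_awayι (reesGrading (I.map (C : R →+* R[X]))) (reesT (C (v j)) (hv' j)) (reesT_mem _ (hv' j))
    Nat.one_pos] at hj
  obtain ⟨q, rfl⟩ := Scheme.Hom.mem_opensRange.mp hj
  let e₁ : (affineBlowup (I.map (C : R →+* R[X]))).presheaf.stalk
      ((Proj.awayι (reesGrading (I.map (C : R →+* R[X]))) (reesT (C (v j)) (hv' j)) (reesT_mem _ (hv' j)) Nat.one_pos).base q) ≃+*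
      Localization.AtPrime q.asIdeal :=
    ((asIso ((Proj.awayι (reesGrading (I.map (C : R →+* R[X]))) (reesT (C (v j)) (hv' j)) (reesT_mem _ (hv' j))
      Nat.one_pos).stalkMap q)).commRingCatIsoToRingEquiv).trans
      (Spec.stalkIso (.of (HomogeneousLocalization.Away (reesGrading (I.map (C : R →+* R[X]))) (reesT (C (v j)) (hv' j)))) q
        ).commRingCatIsoToRingEquiv
  let eC := reesChartEquiv (I := I.map (C : R →+* R[X])) (C (v j)) (hv' j)
  let q₂ : Ideal (blowupAlgebra (I.map (C : R →+* R[X])) (C (v j))) := q.asIdeal.comap eC.symm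
  obtain ⟨e₂⟩ := BlowupFiModelOfCover.nonempty_ringEquiv_localization_of_ringEquiv eC q.asIdeal q₂ fun x => by
    change eC.symm (eC x) ∈ q.asIdeal ↔ x ∈ q.asIdeal
    rw [RingEquiv.symm_apply_apply]
  -- the chart lemma at `q₂`, moved back to the stalk
  obtain ⟨hdom, hcl⟩ := chart_fiClause_polynomial p R I hBl (v j) (hvI j) ha0 q₂
  haveI := hdom
  exact ⟨MulEquiv.isDomain (Localization.AtPrime q₂) (e₁.trans e₂).toMulEquiv,
    DegreeZeroDescent.inlineClause_of_ringEquiv (L := Localization.AtPrime q₂) p (e₁.trans e₂).symm hcl⟩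

end Summit.ResolutionOfSingularities.ResolutionOfSingularities.Theorems.FInjectiveMacaulayfication.AffineBlowupPolynomial

end
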